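import Mathlib.RingTheory.AdicCompletion.LocalRing
import Mathlib.RingTheory.AdicCompletion.AsTensorProduct
import Mathlib.RingTheory.AdicCompletion.Noetherian
import Mathlib.RingTheory.Flat.FaithfullyFlat.Algebra
import Mathlib.Algebra.CharP.Lemmas
import Mathlib.Algebra.CharP.Algebra
import HarnessLib

/-!
# Stub `stub_regularTypeDescends` for crux stmt-ResolutionOfSingularities-15917
(`RadicialJung.CleanModels`, line `Sketch` rev 6)

For a Noetherian local ring `O` of prime characteristic `p` with maximal ideal `𝔪` and
`𝔪`-adic completion `ι : O → Ô = AdicCompletion 𝔪 O`, the two REGULAR TYPES of a clean local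
presentation descend from `Ô` to `O` verbatim:

1. if `ι u - ĉ ^ p ∉ 𝔪̂ := 𝔪.map ι` for every `ĉ ∈ Ô`, then `u - c ^ p ∉ 𝔪` for every `c ∈ O`
   (take `ĉ = ι c` and use `Ideal.mem_map_of_mem`);
2. if `ι s - ĉ ^ p ∈ 𝔪̂ ∖ 𝔪̂²` for some `ĉ ∈ Ô`, then `s - c ^ p ∈ 𝔪 ∖ 𝔪²` for some `c ∈ O`:
   the residue fields of `O` and `Ô` agree (`AdicCompletion.residueField_map_bijective`), so
   `ι c - ĉ ∈ maximalIdeal Ô = 𝔪̂` (`AdicCompletion.maximalIdeal_eq_map`) for some `c`; in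
   characteristic `p`, `(ι c) ^ p - ĉ ^ p = (ι c - ĉ) ^ p ∈ 𝔪̂ ^ p ⊆ 𝔪̂²`; finally `Ô` is
   faithfully flat over `O` (`AdicCompletion.flat_of_isNoetherian`,
   `Module.FaithfullyFlat.of_flat_of_isLocalHom`), so `𝔪̂ ∩ O = 𝔪` and `𝔪̂² ∩ O = 𝔪²`
   (`Ideal.comap_map_eq_self_of_faithfullyFlat`, `Ideal.map_pow`).
-/

noncomputable section

set_option linter.dupNamespace false

open IsLocalRing

namespace Summit.ResolutionOfSingularities.ResolutionOfSingularities.Theorems.RadicialJung.CleanModels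

universe u

/-- **Formal regular types descend.** For a Noetherian local ring `O` of prime characteristic `p`
with `𝔪`-adic completion `ι : O → Ô = AdicCompletion 𝔪 O` and `𝔪̂ := 𝔪.map ι`:
(i) if `ι u - ĉ^p ∉ 𝔪̂` for every `ĉ ∈ Ô` then `u - c^p ∉ 𝔪` for every `c ∈ O`;
(ii) if `ι s - ĉ^p ∈ 𝔪̂ ∖ 𝔪̂²` for some `ĉ ∈ Ô` then `s - c^p ∈ 𝔪 ∖ 𝔪²` for some `c ∈ O`
(pick `c` with `ι c ≡ ĉ (mod 𝔪̂)` using `κ(O) = κ(Ô)`, so `(ι c)^p - ĉ^p = (ι c - ĉ)^p ∈ 𝔪̂²`,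
and pull back along the faithfully flat `ι`: `𝔪̂ ∩ O = 𝔪`, `𝔪̂² ∩ O = 𝔪²`). -/
theorem stub_regularTypeDescends {O : Type u} [CommRing O] [IsLocalRing O] [IsNoetherianRing O]
    (p : ℕ) (hp : p.Prime) [CharP O p] :
    (∀ u : O, (∀ ĉ : AdicCompletion (maximalIdeal O) O,
        algebraMap O (AdicCompletion (maximalIdeal O) O) u - ĉ ^ p ∉
          (maximalIdeal O).map (algebraMap O (AdicCompletion (maximalIdeal O) O))) →
        ∀ c : O, u - c ^ p ∉ maximalIdeal O) ∧
    (∀ s : O, (∃ ĉ : AdicCompletion (maximalIdeal O) O,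
        algebraMap O (AdicCompletion (maximalIdeal O) O) s - ĉ ^ p ∈
          (maximalIdeal O).map (algebraMap O (AdicCompletion (maximalIdeal O) O)) ∧
        algebraMap O (AdicCompletion (maximalIdeal O) O) s - ĉ ^ p ∉
          (maximalIdeal O).map (algebraMap O (AdicCompletion (maximalIdeal O) O)) ^ 2) →
        ∃ c : O, s - c ^ p ∈ maximalIdeal O ∧ s - c ^ p ∉ maximalIdeal O ^ 2) := by
  haveI : Fact p.Prime := ⟨hp⟩
  -- faithful flatness of `O → Ô`: extended ideals contract to themselves
  haveI : Module.FaithfullyFlat O (AdicCompletion (maximalIdeal O) O) :=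
    Module.FaithfullyFlat.of_flat_of_isLocalHom
  have hcomap : ∀ I : Ideal O,
      (I.map (algebraMap O (AdicCompletion (maximalIdeal O) O))).comap
        (algebraMap O (AdicCompletion (maximalIdeal O) O)) = I :=
    fun I => Ideal.comap_map_eq_self_of_faithfullyFlat I
  refine ⟨fun u hu c hc => hu (algebraMap O _ c) ?_, fun s ⟨ĉ, h1, h2⟩ => ?_⟩
  · rw [← map_pow, ← map_sub]
    exact Ideal.mem_map_of_mem _ hc
  · haveI : CharP (AdicCompletion (maximalIdeal O) O) p :=
      charP_of_injective_algebraMap (AdicCompletion.of_injective (maximalIdeal O) O) p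
    -- `κ(O) = κ(Ô)`: approximate `ĉ` by some `ι c` modulo `𝔪̂`
    obtain ⟨ρ, hρ⟩ := (AdicCompletion.residueField_map_bijective O).2 (residue _ ĉ)
    obtain ⟨c, rfl⟩ := Ideal.Quotient.mk_surjective ρ
    have hcĉ : algebraMap O (AdicCompletion (maximalIdeal O) O) c - ĉ ∈
        (maximalIdeal O).map (algebraMap O (AdicCompletion (maximalIdeal O) O)) := by
      rw [← AdicCompletion.maximalIdeal_eq_map, ← Ideal.Quotient.mk_eq_mk_iff_sub_mem]
      exact (IsLocalRing.ResidueField.map_residue _ c).symm.trans hρ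
    -- `(ι c)^p - ĉ^p = (ι c - ĉ)^p ∈ 𝔪̂^p ⊆ 𝔪̂²`
    have hpow : algebraMap O (AdicCompletion (maximalIdeal O) O) c ^ p - ĉ ^ p ∈
        (maximalIdeal O).map (algebraMap O (AdicCompletion (maximalIdeal O) O)) ^ 2 := by
      rw [← sub_pow_char]
      exact Ideal.pow_le_pow_right hp.two_le (Ideal.pow_mem_pow hcĉ p)
    -- rewrite `ι s - ĉ^p = ι (s - c^p) + ((ι c)^p - ĉ^p)`
    have hsplit : algebraMap O (AdicCompletion (maximalIdeal O) O) s - ĉ ^ p =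
        algebraMap O (AdicCompletion (maximalIdeal O) O) (s - c ^ p) +
          (algebraMap O (AdicCompletion (maximalIdeal O) O) c ^ p - ĉ ^ p) := by
      rw [map_sub, map_pow]; ring
    refine ⟨c, ?_, ?_⟩
    · rw [← hcomap (maximalIdeal O), Ideal.mem_comap]
      have := Ideal.sub_mem _ h1 (Ideal.pow_le_self two_ne_zero hpow)
      rwa [hsplit, add_sub_cancel_right] at this
    · intro hs
      apply h2
      rw [hsplit]
      refine Ideal.add_mem _ ?_ hpow
      rw [← Ideal.map_pow]
      exact Ideal.mem_map_of_mem _ hs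

end Summit.ResolutionOfSingularities.ResolutionOfSingularities.Theorems.RadicialJung.CleanModels

end
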